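import Literature.Computability.QuantumComplexity.SolovayKitaev.Diagonal
import HarnessLib

/-!
# Solovay–Kitaev theorem: traceless Hermitian matrices are balanced commutators

Proof infrastructure for the discharge of
`Literature.Computability.QuantumComplexity.solovay_kitaev`.  This file proves **Dawson–Nielsen,
Lemma 2** (*The Solovay–Kitaev algorithm*, QIC **6** (2006) §5.2, p. 9–10; based on Horn–Johnson,
*Topics in Matrix Analysis*, Thm 4.5.2): for a traceless Hermitian `d × d` matrix `H` there are
Hermitian `F, G` with `[F, G] = iH` and `‖F‖, ‖G‖ ≤ C_d √‖H‖`.  We follow the printed proof — pass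
to the basis that is *Fourier conjugate* to an eigenbasis of `H`, where `H` has zero diagonal,
take `G` diagonal with distinct real entries and `F_{jk} = i H_{jk} / (G_{kk} - G_{jj})` — with two
differences that only affect constants: the entries of `G` are `0, 1, …, d-1` shifted to be
traceless (so that `F` and `G` are both *traceless*, which the recursion needs to exponentiate
inside `SU(d)`), and the operator norm of `F` is bounded crudely by the sum of its entries, giving
`C_d = d²` (Dawson–Nielsen: `d^{1/4} ((d-1)/2)^{1/2}`; only the `√‖H‖` scaling matters).

Contents: `norm_le_sum_norm_apply` (operator norm ≤ sum of entries), the discrete Fourier matrix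
is unitary (`dft_mul_star_self`) and kills the diagonal of a traceless diagonal matrix
(`dft_conj_apply_self`), the off-diagonal solution of `[F, diag g] = iZ`
(`offDiag_mul_diagonal_sub`), and the assembled `exists_commutator_eq_smul`.
No definitions and no new statements are introduced; everything is proved.
-/

noncomputable section

open scoped Matrix.Norms.L2Operator ComplexConjugate

namespace Literature.Computability.QuantumComplexity.SolovayKitaev

open Matrix Complex Literature.MathematicalPhysics.QuantumLattice

variable {n : Type*} [Fintype n] [DecidableEq n]

/-! ### Operator norm versus entries -/

omit [DecidableEq n] in
/-- The Euclidean norm is bounded by the sum of the norms of the coordinates. [folklore] -/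
theorem euclidean_norm_le_sum (y : EuclideanSpace ℂ n) : ‖y‖ ≤ ∑ i, ‖y.ofLp i‖ := by
  have hy : y = ∑ i, y.ofLp i • EuclideanSpace.basisFun n ℂ i := by
    conv_lhs => rw [← (EuclideanSpace.basisFun n ℂ).sum_repr y]
    simp only [EuclideanSpace.basisFun_repr]
  calc ‖y‖ = ‖∑ i, y.ofLp i • EuclideanSpace.basisFun n ℂ i‖ := by rw [← hy]
    _ ≤ ∑ i, ‖y.ofLp i • EuclideanSpace.basisFun n ℂ i‖ := norm_sum_le _ _
    _ = ∑ i, ‖y.ofLp i‖ := by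
        refine Finset.sum_congr rfl fun i _ => ?_
        rw [norm_smul, (EuclideanSpace.basisFun n ℂ).orthonormal.norm_eq_one i, mul_one]

/-- The `L²`-operator norm of a matrix is bounded by the sum of the norms of its entries.
[folklore] -/
theorem norm_le_sum_norm_apply (A : Matrix n n ℂ) : ‖A‖ ≤ ∑ j, ∑ k, ‖A j k‖ := by
  rw [Matrix.cstar_norm_def]
  refine ContinuousLinearMap.opNorm_le_bound _ (by positivity) fun x => ?_
  have hx : ∀ k, ‖x.ofLp k‖ ≤ ‖x‖ := fun k => PiLp.norm_apply_le x k
  calc ‖toEuclideanCLM (n := n) (𝕜 := ℂ) A x‖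
      ≤ ∑ j, ‖(toEuclideanCLM (n := n) (𝕜 := ℂ) A x).ofLp j‖ := euclidean_norm_le_sum _
    _ = ∑ j, ‖∑ k, A j k * x.ofLp k‖ := by
        refine Finset.sum_congr rfl fun j _ => ?_
        rw [Matrix.ofLp_toEuclideanCLM]
        rfl
    _ ≤ ∑ j, ∑ k, ‖A j k‖ * ‖x‖ := by
        refine Finset.sum_le_sum fun j _ => (norm_sum_le _ _).trans (Finset.sum_le_sum fun k _ => ?_)
        rw [norm_mul]
        exact mul_le_mul_of_nonneg_left (hx k) (norm_nonneg _)
    _ = (∑ j, ∑ k, ‖A j k‖) * ‖x‖ := by rw [Finset.sum_mul]; simp_rw [Finset.sum_mul]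

/-! ### The discrete Fourier matrix -/

/-- **The discrete Fourier matrix is unitary.**  For a primitive `d`-th root of unity `ω` and a
numbering `e : n ≃ Fin d`, the matrix `Φ_{jk} = ω^{e(j) e(k)} / √d` satisfies `Φ Φ⋆ = 1`
(orthogonality of characters: `∑_k ζ^k = 0` for a `d`-th root of unity `ζ ≠ 1`). [folklore] -/
theorem dft_mul_star_self {d : ℕ} (hd : d ≠ 0) (e : n ≃ Fin d) {ω : ℂ} (hω : IsPrimitiveRoot ω d)
    (Φ : Matrix n n ℂ)
    (hΦ : Φ = Matrix.of fun j k : n => ω ^ ((e j : ℕ) * (e k : ℕ)) / (Real.sqrt d : ℂ)) :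
    Φ * star Φ = 1 := by
  have hω1 : ‖ω‖ = 1 := hω.norm'_eq_one hd
  have hω0 : ω ≠ 0 := norm_ne_zero_iff.1 (by rw [hω1]; exact one_ne_zero)
  have hωconj : conj ω = ω⁻¹ := (inv_eq_conj_of_norm_eq_one hω1).symm
  have hdpos : (0 : ℝ) < d := by exact_mod_cast Nat.pos_of_ne_zero hd
  have hsq : (Real.sqrt d : ℂ) * (Real.sqrt d : ℂ) = (d : ℂ) := by
    rw [← ofReal_mul, Real.mul_self_sqrt hdpos.le, ofReal_natCast]
  have hsq0 : (Real.sqrt d : ℂ) ≠ 0 := by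
    rw [Ne, ofReal_eq_zero]; exact (Real.sqrt_pos.2 hdpos).ne'
  have hdC : (d : ℂ) ≠ 0 := by exact_mod_cast hd
  ext j l
  -- the `(j,l)` entry is `(∑_k ζ^{e k}) / d` with `ζ = ω^{e j} ω^{-e l}`
  set ζ : ℂ := ω ^ (e j : ℕ) * ω⁻¹ ^ (e l : ℕ) with hζ
  have hentry : (Φ * star Φ) j l = (∑ k, ζ ^ (e k : ℕ)) / d := by
    rw [Matrix.mul_apply, Finset.sum_div]
    refine Finset.sum_congr rfl fun k _ => ?_
    rw [Matrix.star_apply, hΦ, of_apply, of_apply, Complex.star_def, map_div₀, map_pow, hωconj,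
      conj_ofReal, div_mul_div_comm, hsq, hζ, mul_pow, ← pow_mul, ← pow_mul, mul_comm (e l : ℕ)]
  have hsumζ : ∑ k, ζ ^ (e k : ℕ) = ∑ i ∈ Finset.range d, ζ ^ i := by
    rw [e.sum_comp (fun m : Fin d => ζ ^ (m : ℕ)), Fin.sum_univ_eq_sum_range (fun i => ζ ^ i) d]
  rw [hentry, hsumζ, one_apply]
  by_cases hjl : j = l
  · subst hjl
    have hζ1 : ζ = 1 := by rw [hζ, ← mul_pow, mul_inv_cancel₀ hω0, one_pow]
    rw [if_pos rfl, hζ1]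
    simp only [one_pow, Finset.sum_const, Finset.card_range, nsmul_eq_mul, mul_one]
    exact div_self hdC
  · rw [if_neg hjl]
    have hζne : ζ ≠ 1 := by
      intro h1
      apply hjl
      have h2 : ω ^ (e j : ℕ) = ω ^ (e l : ℕ) := by
        have h3 : ω ^ (e j : ℕ) * ω⁻¹ ^ (e l : ℕ) * ω ^ (e l : ℕ) = ω ^ (e l : ℕ) := by
          rw [← hζ, h1, one_mul]
        rwa [mul_assoc, ← mul_pow, inv_mul_cancel₀ hω0, one_pow, mul_one] at h3
      have h4 : (e j : ℕ) = (e l : ℕ) := hω.pow_inj (e j).2 (e l).2 h2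
      exact e.injective (Fin.ext h4)
    have hζd : ζ ^ d = 1 := by
      rw [hζ, mul_pow, ← pow_mul, ← pow_mul, mul_comm (e j : ℕ) d, mul_comm (e l : ℕ) d, pow_mul,
        pow_mul, hω.pow_eq_one, one_pow, inv_pow, hω.pow_eq_one, inv_one, one_pow, mul_one]
    rw [geom_sum_eq hζne, hζd, sub_self, zero_div, zero_div]

/-- **Fourier conjugation kills the diagonal of a traceless diagonal matrix** (Dawson–Nielsen
2006, eq. after (17): `H_{jj} = ∑_k E_k / d = tr(H)/d`).  With `Φ` as in `dft_mul_star_self`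
(all entries of modulus `1/√d`), `(Φ⋆ · diag(E) · Φ)_{jj} = (∑_k E_k)/d`.
[cite: DawsonNielsen2006, §5.2 Lemma 2] -/
theorem dft_conj_apply_self {d : ℕ} (hd : d ≠ 0) (e : n ≃ Fin d) {ω : ℂ} (hω1 : ‖ω‖ = 1)
    (Φ : Matrix n n ℂ)
    (hΦ : Φ = Matrix.of fun j k : n => ω ^ ((e j : ℕ) * (e k : ℕ)) / (Real.sqrt d : ℂ))
    (E : n → ℂ) (j : n) :
    (star Φ * diagonal E * Φ) j j = (∑ k, E k) / d := by
  have hdpos : (0 : ℝ) < d := by exact_mod_cast Nat.pos_of_ne_zero hd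
  have hnorm : ∀ k, (‖Φ k j‖ : ℂ) ^ 2 = 1 / d := by
    intro k
    rw [hΦ, of_apply, norm_div, norm_pow, hω1, one_pow, Complex.norm_real, Real.norm_eq_abs,
      abs_of_nonneg (Real.sqrt_nonneg _), ofReal_div, ofReal_one, div_pow, one_pow, ← ofReal_pow,
      Real.sq_sqrt hdpos.le, ofReal_natCast]
  rw [Matrix.mul_apply, Finset.sum_div]
  refine Finset.sum_congr rfl fun k _ => ?_
  rw [mul_diagonal, Matrix.star_apply, Complex.star_def]
  calc conj (Φ k j) * E k * Φ k j = E k * (conj (Φ k j) * Φ k j) := by ring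
    _ = E k * (1 / d) := by rw [Complex.conj_mul', hnorm]
    _ = E k / d := by rw [mul_one_div]

/-! ### Solving `[F, diag g] = iZ` off the diagonal -/

/-- **The off-diagonal solution** (Dawson–Nielsen 2006, eq. (18)): if `Z` has zero diagonal and
`g` is real with pairwise differences `≥ 1`, then `F_{jk} = i Z_{jk} / (g_k - g_j)` (`F_{jj} = 0`)
satisfies `F · diag(g) - diag(g) · F = iZ`. [cite: DawsonNielsen2006, §5.2 Lemma 2] -/
theorem offDiag_mul_diagonal_sub {Z F : Matrix n n ℂ} {g : n → ℝ} (hZ : ∀ j, Z j j = 0)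
    (hg : ∀ j k, j ≠ k → 1 ≤ |g k - g j|)
    (hF : F = Matrix.of fun j k : n => if j = k then 0 else I * Z j k / ((g k : ℂ) - g j)) :
    F * diagonal (fun k => ((g k : ℝ) : ℂ)) - diagonal (fun k => ((g k : ℝ) : ℂ)) * F = I • Z := by
  ext j k
  rw [Matrix.sub_apply, mul_diagonal, diagonal_mul, Matrix.smul_apply, smul_eq_mul, hF, of_apply]
  by_cases hjk : j = k
  · subst hjk
    rw [if_pos rfl, hZ]
    ring
  · rw [if_neg hjk]
    have hne : ((g k : ℝ) : ℂ) - g j ≠ 0 := by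
      rw [← ofReal_sub, Ne, ofReal_eq_zero]
      have := hg j k hjk
      intro h0
      rw [h0, abs_zero] at this
      exact absurd this (by norm_num)
    field_simp

omit [Fintype n] in
/-- The off-diagonal solution is Hermitian when `Z` is. [folklore] -/
theorem offDiag_isHermitian {Z F : Matrix n n ℂ} {g : n → ℝ} (hZ : Z.IsHermitian)
    (hg : ∀ j k, j ≠ k → 1 ≤ |g k - g j|)
    (hF : F = Matrix.of fun j k : n => if j = k then 0 else I * Z j k / ((g k : ℂ) - g j)) :
    F.IsHermitian := by
  rw [hF]
  ext j k
  rw [conjTranspose_apply, of_apply, of_apply]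
  by_cases hjk : j = k
  · subst hjk
    simp
  · have hZ' : conj (Z k j) = Z j k := hZ.apply j k
    rw [if_neg hjk, if_neg (Ne.symm hjk), Complex.star_def, map_div₀, map_mul, conj_I, map_sub,
      conj_ofReal, conj_ofReal, hZ']
    have hne : ((g k : ℝ) : ℂ) - g j ≠ 0 := by
      rw [← ofReal_sub, Ne, ofReal_eq_zero]
      have := hg j k hjk
      intro h0
      rw [h0, abs_zero] at this
      exact absurd this (by norm_num)
    have hne' : ((g j : ℝ) : ℂ) - g k ≠ 0 := by
      rw [← ofReal_sub, Ne, ofReal_eq_zero]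
      have := hg k j (Ne.symm hjk)
      intro h0
      rw [h0, abs_zero] at this
      exact absurd this (by norm_num)
    field_simp
    ring

/-- The off-diagonal solution is traceless. [folklore] -/
theorem offDiag_trace {Z F : Matrix n n ℂ} {g : n → ℝ}
    (hF : F = Matrix.of fun j k : n => if j = k then 0 else I * Z j k / ((g k : ℂ) - g j)) :
    F.trace = 0 := by
  rw [hF, Matrix.trace]
  simp

/-- Norm of the off-diagonal solution: `‖F‖ ≤ |n|² ‖Z‖` (entries `|F_{jk}| ≤ |Z_{jk}| ≤ ‖Z‖`).
[folklore] -/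
theorem offDiag_norm_le {Z F : Matrix n n ℂ} {g : n → ℝ}
    (hg : ∀ j k, j ≠ k → 1 ≤ |g k - g j|)
    (hF : F = Matrix.of fun j k : n => if j = k then 0 else I * Z j k / ((g k : ℂ) - g j)) :
    ‖F‖ ≤ (Fintype.card n : ℝ) ^ 2 * ‖Z‖ := by
  have hentry : ∀ j k, ‖F j k‖ ≤ ‖Z‖ := by
    intro j k
    rw [hF, of_apply]
    by_cases hjk : j = k
    · subst hjk; simp
    · rw [if_neg hjk, norm_div, norm_mul, Complex.norm_I, one_mul, ← ofReal_sub, Complex.norm_real,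
        Real.norm_eq_abs]
      exact (div_le_self (norm_nonneg _) (hg j k hjk)).trans (norm_apply_le_norm Z j k)
  calc ‖F‖ ≤ ∑ j, ∑ k, ‖F j k‖ := norm_le_sum_norm_apply F
    _ ≤ ∑ _j : n, ∑ _k : n, ‖Z‖ := Finset.sum_le_sum fun j _ => Finset.sum_le_sum fun k _ => hentry j k
    _ = (Fintype.card n : ℝ) ^ 2 * ‖Z‖ := by simp [sq, mul_assoc]

/-! ### Dawson–Nielsen Lemma 2 -/

/-- **Dawson–Nielsen Lemma 2** (QIC 6 (2006) §5.2; Horn–Johnson, *Topics*, Thm 4.5.2): a traceless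
Hermitian matrix `H` is `-i` times a commutator of Hermitian matrices of norm `O(√‖H‖)`: there are
Hermitian **traceless** `F, G` with `F G - G F = iH` and `‖F‖, ‖G‖ ≤ |n|² √‖H‖`.  (Printed constant:
`d^{1/4}((d-1)/2)^{1/2}`; the tracelessness of `F, G`, not stated by Dawson–Nielsen, holds for
their construction once the diagonal `G` is centred.) [cite: DawsonNielsen2006, §5.2 Lemma 2] -/
theorem exists_commutator_eq_smul (H : Matrix n n ℂ) (hH : H.IsHermitian) (htr : H.trace = 0) :
    ∃ F G : Matrix n n ℂ, F.IsHermitian ∧ G.IsHermitian ∧ F.trace = 0 ∧ G.trace = 0 ∧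
      F * G - G * F = I • H ∧
      ‖F‖ ≤ (Fintype.card n : ℝ) ^ 2 * Real.sqrt ‖H‖ ∧
      ‖G‖ ≤ (Fintype.card n : ℝ) ^ 2 * Real.sqrt ‖H‖ := by
  by_cases hH0 : H = 0
  · subst hH0
    refine ⟨0, 0, isHermitian_zero, isHermitian_zero, Matrix.trace_zero n ℂ, Matrix.trace_zero n ℂ,
      by simp, by simp, by simp⟩
  -- `n` is nonempty and `d = |n| ≥ 1`
  have hn : Nonempty n := by
    by_contra h
    rw [not_nonempty_iff] at h
    exact hH0 (Subsingleton.elim _ _)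
  have hd : Fintype.card n ≠ 0 := Fintype.card_ne_zero
  have hdpos : (0 : ℝ) < Fintype.card n := by exact_mod_cast Nat.pos_of_ne_zero hd
  have hd1 : (1 : ℝ) ≤ Fintype.card n := by exact_mod_cast Nat.pos_of_ne_zero hd
  set e : n ≃ Fin (Fintype.card n) := Fintype.equivFin n with he
  -- spectral decomposition `H = Q diag(E) Q⋆`
  set Q : Matrix n n ℂ := (hH.eigenvectorUnitary : Matrix n n ℂ) with hQdef
  have hQ : Q ∈ Matrix.unitaryGroup n ℂ := hH.eigenvectorUnitary.2
  set E : n → ℂ := fun k => ((hH.eigenvalues k : ℝ) : ℂ) with hEdef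
  have hHconj : H = Q * diagonal E * star Q := by
    have h := hH.spectral_theorem
    rw [Unitary.conjStarAlgAut_apply] at h
    exact h
  have hEsum : ∑ k, E k = 0 := by
    have h := hH.trace_eq_sum_eigenvalues
    rw [htr, RCLike.ofReal_eq_complex_ofReal] at h
    exact h.symm
  have hEherm : (diagonal E).IsHermitian :=
    Matrix.isHermitian_diagonal_iff.2 fun k => by
      rw [isSelfAdjoint_iff, hEdef, Complex.star_def, Complex.conj_ofReal]
  -- the Fourier matrix
  set ω : ℂ := cexp (2 * Real.pi * I / (Fintype.card n : ℕ)) with hωdef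
  have hω : IsPrimitiveRoot ω (Fintype.card n) := Complex.isPrimitiveRoot_exp _ hd
  have hω1 : ‖ω‖ = 1 := hω.norm'_eq_one hd
  set Φ : Matrix n n ℂ := Matrix.of fun j k : n =>
    ω ^ ((e j : ℕ) * (e k : ℕ)) / (Real.sqrt (Fintype.card n : ℕ) : ℂ) with hΦ
  have hΦΦ : Φ * star Φ = 1 := dft_mul_star_self hd e hω Φ hΦ
  have hΦU : Φ ∈ Matrix.unitaryGroup n ℂ := Matrix.mem_unitaryGroup_iff.2 hΦΦ
  -- the zero-diagonal conjugate `Z = Φ⋆ diag(E) Φ` and `H = R Z R⋆`, `R = Q Φ`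
  set Z : Matrix n n ℂ := star Φ * diagonal E * Φ with hZdef
  have hZdiag : ∀ j, Z j j = 0 := fun j => by
    rw [hZdef, dft_conj_apply_self hd e hω1 Φ hΦ E j, hEsum, zero_div]
  have hZherm : Z.IsHermitian := by
    have h := isHermitian_conjTranspose_mul_mul Φ hEherm
    rwa [← star_eq_conjTranspose] at h
  set R : Matrix n n ℂ := Q * Φ with hRdef
  have hR : R ∈ Matrix.unitaryGroup n ℂ := Submonoid.mul_mem _ hQ hΦU
  have hRR : star R * R = 1 := Unitary.star_mul_self_of_mem hR
  have hHR : H = R * Z * star R := by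
    rw [hHconj, hRdef, hZdef, star_mul]
    calc Q * diagonal E * star Q
        = Q * (Φ * star Φ) * diagonal E * (Φ * star Φ) * star Q := by
          rw [hΦΦ, Matrix.mul_one, Matrix.mul_one]
      _ = Q * Φ * (star Φ * diagonal E * Φ) * (star Φ * star Q) := by noncomm_ring
  have hZnorm : ‖Z‖ = ‖H‖ := by rw [hHR, norm_unitary_conj hR]
  -- the centred numbering `g`
  set g : n → ℝ := fun k => ((e k : ℕ) : ℝ) - ((Fintype.card n : ℝ) - 1) / 2 with hgdef
  have hg1 : ∀ j k, j ≠ k → 1 ≤ |g k - g j| := by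
    intro j k hjk
    have hne : ((e k : ℕ) : ℤ) - ((e j : ℕ) : ℤ) ≠ 0 := by
      rw [sub_ne_zero]
      intro h
      exact hjk (e.injective (Fin.ext (by exact_mod_cast h.symm)))
    have h1 : (1 : ℤ) ≤ |((e k : ℕ) : ℤ) - ((e j : ℕ) : ℤ)| := Int.one_le_abs hne
    have h2 : g k - g j = ((((e k : ℕ) : ℤ) - ((e j : ℕ) : ℤ) : ℤ) : ℝ) := by
      rw [hgdef]; push_cast; ring
    rw [h2, ← Int.cast_abs]
    exact_mod_cast h1
  have hgsum : ∑ k, ((g k : ℝ) : ℂ) = 0 := by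
    rw [← ofReal_sum, ofReal_eq_zero, hgdef]
    simp only [Finset.sum_sub_distrib, Finset.sum_const, Finset.card_univ, nsmul_eq_mul]
    have hS : ∑ k, ((e k : ℕ) : ℝ) = (Fintype.card n : ℝ) * ((Fintype.card n : ℝ) - 1) / 2 := by
      rw [e.sum_comp (fun m : Fin (Fintype.card n) => ((m : ℕ) : ℝ)),
        Fin.sum_univ_eq_sum_range (fun i => (i : ℝ)) (Fintype.card n)]
      have h := Finset.sum_range_id_mul_two (Fintype.card n)
      have h1 : ((Fintype.card n - 1 : ℕ) : ℝ) = (Fintype.card n : ℝ) - 1 := by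
        rw [Nat.cast_sub (Nat.pos_of_ne_zero hd), Nat.cast_one]
      have h' : ((∑ i ∈ Finset.range (Fintype.card n), i : ℕ) : ℝ) * 2 =
          (Fintype.card n : ℝ) * ((Fintype.card n : ℝ) - 1) := by
        rw [← h1]
        exact_mod_cast h
      rw [Nat.cast_sum] at h'
      linarith
    rw [hS]
    ring
  have hgabs : ∀ k, |g k| ≤ Fintype.card n := by
    intro k
    have h0 : (0 : ℝ) ≤ ((e k : ℕ) : ℝ) := Nat.cast_nonneg _
    have h1 : ((e k : ℕ) : ℝ) + 1 ≤ Fintype.card n := by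
      exact_mod_cast Nat.succ_le_of_lt (e k).2
    rw [hgdef, abs_le]
    constructor <;> linarith
  -- `G₀ = diag g`, `F₀` the off-diagonal solution
  set G₀ : Matrix n n ℂ := diagonal fun k => ((g k : ℝ) : ℂ) with hG₀
  set F₀ : Matrix n n ℂ := Matrix.of fun j k : n =>
    if j = k then 0 else I * Z j k / ((g k : ℂ) - g j) with hF₀
  have hcomm₀ : F₀ * G₀ - G₀ * F₀ = I • Z := offDiag_mul_diagonal_sub hZdiag hg1 hF₀
  have hF₀herm : F₀.IsHermitian := offDiag_isHermitian hZherm hg1 hF₀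
  have hF₀tr : F₀.trace = 0 := offDiag_trace hF₀
  have hF₀norm : ‖F₀‖ ≤ (Fintype.card n : ℝ) ^ 2 * ‖H‖ := by
    rw [← hZnorm]; exact offDiag_norm_le hg1 hF₀
  have hG₀herm : G₀.IsHermitian :=
    Matrix.isHermitian_diagonal_iff.2 fun k => by
      rw [isSelfAdjoint_iff, Complex.star_def, Complex.conj_ofReal]
  have hG₀tr : G₀.trace = 0 := by rw [hG₀, trace_diagonal, hgsum]
  have hG₀norm : ‖G₀‖ ≤ Fintype.card n := by
    refine norm_diagonal_le hdpos.le fun k => ?_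
    rw [Complex.norm_real, Real.norm_eq_abs]
    exact hgabs k
  -- rescale by `s = √‖H‖` and conjugate back by `R`
  set s : ℝ := Real.sqrt ‖H‖ with hsdef
  have hHpos : 0 < ‖H‖ := norm_pos_iff.2 hH0
  have hs : 0 < s := Real.sqrt_pos.2 hHpos
  have hss : s * s = ‖H‖ := Real.mul_self_sqrt hHpos.le
  have hconjHerm : ∀ {X : Matrix n n ℂ}, X.IsHermitian → ∀ c : ℝ,
      ((c : ℂ) • (R * X * star R)).IsHermitian := by
    intro X hX c
    have h1 : (R * X * star R).IsHermitian := by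
      simpa only [star_eq_conjTranspose] using isHermitian_mul_mul_conjTranspose R hX
    change ((c : ℂ) • (R * X * star R))ᴴ = (c : ℂ) • (R * X * star R)
    rw [conjTranspose_smul, h1.eq]
    congr 1
    exact Complex.conj_ofReal c
  have hconjTr : ∀ {X : Matrix n n ℂ}, X.trace = 0 → ∀ c : ℂ, (c • (R * X * star R)).trace = 0 := by
    intro X hX c
    rw [trace_smul, trace_mul_cycle, hRR, Matrix.one_mul, hX, smul_zero]
  refine ⟨((s⁻¹ : ℝ) : ℂ) • (R * F₀ * star R), ((s : ℝ) : ℂ) • (R * G₀ * star R),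
    hconjHerm hF₀herm _, hconjHerm hG₀herm _, hconjTr hF₀tr _, hconjTr hG₀tr _, ?_, ?_, ?_⟩
  · -- the commutator
    have hab : ((s⁻¹ : ℝ) : ℂ) * ((s : ℝ) : ℂ) = 1 := by
      rw [← ofReal_mul, inv_mul_cancel₀ hs.ne', ofReal_one]
    have h1 : R * F₀ * star R * (R * G₀ * star R) = R * (F₀ * G₀) * star R := by
      calc R * F₀ * star R * (R * G₀ * star R) = R * F₀ * (star R * R) * G₀ * star R := by
            noncomm_ring
        _ = R * (F₀ * G₀) * star R := by rw [hRR]; noncomm_ring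
    have h2 : R * G₀ * star R * (R * F₀ * star R) = R * (G₀ * F₀) * star R := by
      calc R * G₀ * star R * (R * F₀ * star R) = R * G₀ * (star R * R) * F₀ * star R := by
            noncomm_ring
        _ = R * (G₀ * F₀) * star R := by rw [hRR]; noncomm_ring
    rw [Matrix.smul_mul, Matrix.mul_smul, smul_smul, Matrix.smul_mul, Matrix.mul_smul, smul_smul,
      hab, mul_comm ((s : ℝ) : ℂ), hab, one_smul, one_smul, h1, h2, ← Matrix.sub_mul,
      ← Matrix.mul_sub, hcomm₀, Matrix.mul_smul, Matrix.smul_mul, ← hHR]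
  · -- ‖F‖
    rw [norm_smul, norm_unitary_conj hR, Complex.norm_real, Real.norm_eq_abs, abs_of_pos (inv_pos.2 hs)]
    calc s⁻¹ * ‖F₀‖ ≤ s⁻¹ * ((Fintype.card n : ℝ) ^ 2 * ‖H‖) :=
          mul_le_mul_of_nonneg_left hF₀norm (inv_pos.2 hs).le
      _ = (Fintype.card n : ℝ) ^ 2 * s := by rw [← hss]; field_simp
  · -- ‖G‖
    rw [norm_smul, norm_unitary_conj hR, Complex.norm_real, Real.norm_eq_abs, abs_of_pos hs]
    calc s * ‖G₀‖ ≤ s * Fintype.card n := mul_le_mul_of_nonneg_left hG₀norm hs.le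
      _ ≤ s * (Fintype.card n : ℝ) ^ 2 := by
          refine mul_le_mul_of_nonneg_left ?_ hs.le
          nlinarith
      _ = (Fintype.card n : ℝ) ^ 2 * s := by ring

end Literature.Computability.QuantumComplexity.SolovayKitaev
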